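import Summits.AtomisticToContinuum.FouriersLaw.Theses.PhononMeanFreePath
import Summits.AtomisticToContinuum.FouriersLaw.Theorems.PhononMeanFreePathDefs
import Summits.AtomisticToContinuum.FouriersLaw.Theorems.PhononMeanFreePathCoherentDephasingWeakCouplingIntegrability
import Summits.AtomisticToContinuum.FouriersLaw.Theorems.PhononMeanFreePathCoherentDephasingResponseRegularity
import Summits.AtomisticToContinuum.FouriersLaw.Theorems.PhononMeanFreePathCoherentDephasingMeanFieldDuhamel
import Summits.AtomisticToContinuum.FouriersLaw.Theorems.PhononMeanFreePathCoherentDephasingHarmFluxBound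
import Summits.AtomisticToContinuum.FouriersLaw.Theorems.PhononMeanFreePathCoherentDephasingSiteBookkeeping
import Summits.AtomisticToContinuum.FouriersLaw.Theorems.PhononMeanFreePathCoherentDephasingTelescoping
import Summits.AtomisticToContinuum.FouriersLaw.Theorems.PhononMeanFreePathCoherentDephasingLossComposition
import Summits.AtomisticToContinuum.FouriersLaw.Theorems.PhononMeanFreePathCoherentDephasingOfLocalLossBound

/-!
# The total local loss equals the kick energy (line `Sketch`, crux stmt-AtomisticToContinuum-11810)

For the Gibbs-averaged linear response of a momentum kick at site `0` of the `(N+1)`-site pinned anharmonic chain with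
Langevin baths at sites `0` and `N`, the TOTAL local loss at site `x` is
`s'_x = siteWork x + γ([x = 0] + [x = N]) ∫₀^∞ m_x²` (anharmonic site work plus bath dissipation). Summing the landed site
balances `stub_siteBookkeeping_of_meanField` (`Σ_b [b+1 = x] Ĵ_b + [x = 0] T²/2 = Σ_b [b = x] Ĵ_b + s'_x`) over all
sites, both harmonic-flux indicator sums collapse to `Σ_b Ĵ_b` (bond `b` has exactly one right site `b.succ` and one
left site `b.castSucc` in `Fin (N+1)`) and cancel, leaving `Σ_x s'_x = T²/2`: the kick's coherent energy is entirely
booked as local losses, for every `N`.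
-/

noncomputable section

open MeasureTheory Set Filter Topology

namespace Summit.AtomisticToContinuum.FouriersLaw.Theorems.CoherentDephasing.TotalLocalLoss

open Literature.MathematicalPhysics.KineticTheory.HeatConduction (pinnedChain PhaseSpace)
open Summit.AtomisticToContinuum.FouriersLaw.Theorems.PhononMeanFreePath
open Summit.AtomisticToContinuum.FouriersLaw.Theorems.CoherentDephasing.MeanFieldDuhamel (stub_meanFieldDuhamel)
open Summit.AtomisticToContinuum.FouriersLaw.Theorems.CoherentDephasing.ResponseRegularity (stub_responseRegularity)
open Summit.AtomisticToContinuum.FouriersLaw.Theorems.CoherentDephasing.SiteBookkeeping (stub_siteBookkeeping_of_meanField)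

section Algebra

variable {N : ℕ}

/-- `Σ_x [b + 1 = x] c = c`: bond `b` has exactly one right site `b.succ` in `Fin (N+1)`. [folklore] -/
theorem sum_ite_val_succ_eq (b : Fin N) (c : ℝ) :
    ∑ x : Fin (N + 1), (if (b : ℕ) + 1 = (x : ℕ) then c else 0) = c := by
  rw [Finset.sum_eq_single b.succ]
  · simp
  · intro x _ hx
    have h : (b : ℕ) + 1 ≠ (x : ℕ) := fun h => hx (Fin.ext (by rw [Fin.val_succ]; exact h.symm))
    simp [h]
  · exact fun h => absurd (Finset.mem_univ _) h

/-- `Σ_x [b = x] c = c`: bond `b` has exactly one left site `b.castSucc` in `Fin (N+1)`. [folklore] -/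
theorem sum_ite_val_castSucc_eq (b : Fin N) (c : ℝ) :
    ∑ x : Fin (N + 1), (if (b : ℕ) = (x : ℕ) then c else 0) = c := by
  rw [Finset.sum_eq_single b.castSucc]
  · simp
  · intro x _ hx
    have h : (b : ℕ) ≠ (x : ℕ) := fun h => hx (Fin.ext (by rw [Fin.val_castSucc]; exact h.symm))
    simp [h]
  · exact fun h => absurd (Finset.mem_univ _) h

/-- `Σ_x [x = 0] c = c`: the kicked site `0`. [folklore] -/
theorem sum_ite_val_zero_eq (c : ℝ) :
    ∑ x : Fin (N + 1), (if (x : ℕ) = 0 then c else 0) = c := by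
  rw [Finset.sum_eq_single 0]
  · simp
  · intro x _ hx
    have h : (x : ℕ) ≠ 0 := fun h => hx (Fin.ext h)
    simp [h]
  · exact fun h => absurd (Finset.mem_univ _) h

/-- `Σ_x Σ_b [b + 1 = x] J_b = Σ_b J_b` (sum of the incoming fluxes over all sites). [folklore] -/
theorem sum_sum_ite_val_succ_eq (J : Fin N → ℝ) :
    ∑ x : Fin (N + 1), (∑ b : Fin N, if (b : ℕ) + 1 = (x : ℕ) then J b else 0) = ∑ b : Fin N, J b := by
  rw [Finset.sum_comm]
  exact Finset.sum_congr rfl fun b _ => sum_ite_val_succ_eq b _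

/-- `Σ_x Σ_b [b = x] J_b = Σ_b J_b` (sum of the outgoing fluxes over all sites). [folklore] -/
theorem sum_sum_ite_val_castSucc_eq (J : Fin N → ℝ) :
    ∑ x : Fin (N + 1), (∑ b : Fin N, if (b : ℕ) = (x : ℕ) then J b else 0) = ∑ b : Fin N, J b := by
  rw [Finset.sum_comm]
  exact Finset.sum_congr rfl fun b _ => sum_ite_val_castSucc_eq b _

end Algebra

/-- **The total local loss equals the kick energy.** For every admissible parameter point and every chain length `N`,
`Σ_{x=0}^{N} (siteWork x + γ([x = 0] + [x = N]) ∫₀^∞ m_x²) = T²/2`: summing the site balances of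
`stub_siteBookkeeping_of_meanField` over all sites, the harmonic fluxes cancel. [folklore] -/
theorem sum_totalLocalLoss_eq :
    ∀ ω₂ lam β γ : ℝ, 0 < ω₂ → 0 < lam → 0 < β → 0 < γ → ∀ T : ℝ, 0 < T → ∀ N : ℕ,
      ∑ x : Fin (N + 1), (siteWork ω₂ lam β γ T N x +
        γ * ((if (x : ℕ) = 0 then 1 else 0) + (if (x : ℕ) = N then 1 else 0)) *
          ∫ t in Set.Ioi (0 : ℝ), momResp ω₂ lam β γ T N x t ^ 2) = T ^ 2 / 2 := by
  intro ω₂ lam β γ hω hl hβ hγ T hT N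
  have hbook := stub_siteBookkeeping_of_meanField ω₂ lam β γ hω hl hβ hγ T hT N
    (stub_meanFieldDuhamel ω₂ lam β γ hω hl hβ hγ T hT N) (stub_responseRegularity ω₂ lam β γ hω hl hβ hγ T hT N)
  -- sum the site balances over all sites
  have h : ∑ x : Fin (N + 1), ((∑ b : Fin N, if (b : ℕ) + 1 = (x : ℕ) then harmFlux ω₂ lam β γ T N b else 0) +
      (if (x : ℕ) = 0 then T ^ 2 / 2 else 0)) =
    ∑ x : Fin (N + 1), ((∑ b : Fin N, if (b : ℕ) = (x : ℕ) then harmFlux ω₂ lam β γ T N b else 0) +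
      siteWork ω₂ lam β γ T N x +
      γ * ((if (x : ℕ) = 0 then 1 else 0) + (if (x : ℕ) = N then 1 else 0)) *
        ∫ t in Ioi (0 : ℝ), momResp ω₂ lam β γ T N x t ^ 2) :=
    Finset.sum_congr rfl fun x _ => hbook.1 x
  have hL := sum_sum_ite_val_succ_eq (harmFlux ω₂ lam β γ T N)
  have hR := sum_sum_ite_val_castSucc_eq (harmFlux ω₂ lam β γ T N)
  have h0 : ∑ x : Fin (N + 1), (if (x : ℕ) = 0 then T ^ 2 / 2 else (0 : ℝ)) = T ^ 2 / 2 := sum_ite_val_zero_eq _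
  simp only [Finset.sum_add_distrib] at h ⊢
  linarith

end Summit.AtomisticToContinuum.FouriersLaw.Theorems.CoherentDephasing.TotalLocalLoss

end
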